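import Summits.QuantumFields.BalabanUV.T4Continuum.Support.HolonomyTowerRegularBridge

/-!
# T⁴ programme, spine node NE2 (U1a), row B2.w — THE HODGE-FORM MODEL AS ONE B2-SLOT LAW: `covPertC + hodgeCorr = lift (½curlᴴcurl + divᴴdiv) − Lap ⊗ 1`
# gets the target shape from ONE regularity binder, ONE NE3 binder and the mixed-shift laws (the ALTERNATIVE B2 slot for row B7)

NE2 formalisation swarm `t4-ne2-formalise-*`, leaf prover 10 (gen 2); third file of the leaf-proposed row «B2.w-feed» (owner ruling R16: «then B7 v1.x
may offer the Hodge-form variant of the B2 slot as an ALTERNATIVE model (c5: still no B0)»).  Rows in the tree: B2 `ColourCovariantLaplacian`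
(`covPertC R k = covLapC (L^k) (R k) − lapC (L^k)`), B2.w `LatticeWeitzenbock` / `WeitzenbockBridge` (`lift (Hodge form) − covLapC = hodgeCorr`),
B2.w-laws `HodgeCorrectionLaws`, B2.w-feed `HolonomyTowerRegular(Bridge)`.  Here, for SLOT-INDEPENDENT site transporters `Rb`:
 * **`hodgePert L M Rb k := covPertC (liftR ∘ Rb) k + hodgeCorr L M Rb k`** and the EXACT identity **`hodgePert_eq`**:
   `hodgePert k = lift (½•curlᴴcurl + divᴴdiv)(D0 (L^k) (Rb k)) − lapC (L^k)` — the Hodge-form covariant operator minus the free componentwise one;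
   `hodgePert_trivial` (= 0 at `Rb ≡ 1`: the model operator IS `Δ_a ⊗ 1` there BY CONSTRUCTION, c5);
 * **`perturbationLaws_covariantLaplacian_of_regular₂`**: row B2's law re-fed from the B2.w binders — `hreg₂ : RegularSites L M Rb α β β₂` and
   `hNE3 : LocalRate (bgReadings (regClass₂ Rb)) C L⁻¹` (the derivative-tower consistency of row B5's `boundedBackgroundM_of_regular` is supplied by
   `HolonomyTowerRegularBridge.dconnTower_consistent`, constant `βNE3 + β₂`);
 * **`perturbationLaws_hodgeModel`**: `hreg₂`, `hNE3`, `hS` (the owner's `shiftLaws_mixed`, `cm = 2Cst`) ⟹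
   `PerturbationLaws (Δ_a⊗1) (hodgePert L M Rb) (J⊗1) (κ_col + κ_w) (k ↦ (C₂^col + C_w)·L^{−k})` (`PerturbationAlgebra.perturbationLaws_add`) —
   the ALTERNATIVE B2 slot, pluggable BY NAME where `perturbationLaws_covariantLaplacian_of_regular` sits in row B7's assembly.

HONEST FRAMING (T4-DAG p. 1).  Assembly OURS at MODEL LEVEL (Rb DATA; hypothesis structures on data; nothing printed is a hypothesis); it does NOT
assert that [Balaban1985BackgroundPropagators] (3.10)'s Hessian is the Hodge form nor the dictionary B0 (c5); whether ROOT B needs this variant is the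
carver's c1; CONDITIONAL on node NE3 (c2/c7) and the regularity class incl. the (3.36)-shape datum (c3); NOT [B9] (3.10)/(3.23)–(3.26) as printed;
NE2 NOT PROVED; NOT infinite volume, NOT a mass gap, NOT Clay, NOT summit progress; spine 0/9 unchanged.  HONEST DEPENDENCY: continuum YM on T⁴ ⇐
BetaPertH ∧ nine spine estimates (0/9 proved); BetaPertH ⇐ (D1) ∧ (D4) ∧ CAP+tail; G-an2-4 gates asym, D1 and NE2/3/4.  ABSOLUTE RULE kept; no
`def … : Prop` fact; no `sorry`.
-/

noncomputable section

open scoped BigOperators ComplexConjugate Matrix Matrix.Norms.L2Operator Kronecker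

namespace Summit.QuantumFields.BalabanUV.T4Continuum.HodgeModelSlot

open Literature.MathematicalPhysics.QuantumFieldTheory.Balaban1983to89.B5Prop11Plancherel
open Literature.MathematicalPhysics.QuantumFieldTheory.Balaban1983to89.B5G183RateUnitTower (lev lev_neZero)
open Literature.MathematicalPhysics.QuantumFieldTheory.Balaban1983to89.T4EtaRateMin (LocalRate)
open Summit.QuantumFields.BalabanUV.T4Continuum
open Summit.QuantumFields.BalabanUV.T4Continuum.BalabanAveragedTowerUnit (idx)
open Summit.QuantumFields.BalabanUV.T4Continuum.BackgroundResolventTower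
open Summit.QuantumFields.BalabanUV.T4Continuum.KingPairingPlantedLaw
open Summit.QuantumFields.BalabanUV.T4Continuum.BlockMultiplication
open Summit.QuantumFields.BalabanUV.T4Continuum.KroneckerLift (sub_kronecker)
open Summit.QuantumFields.BalabanUV.T4Continuum.PerturbationAlgebra (perturbationLaws_add)
open Summit.QuantumFields.BalabanUV.T4Continuum.ColourCovariantLaplacian (covPertC covLapC lapC kappaCol C2col
  perturbationLaws_colourCovariantLaplacian lipschitzBackground_entry boundedBackground_entry)
open Summit.QuantumFields.BalabanUV.T4Continuum.TransportedSiteAveraging (Dc Jc)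
open Summit.QuantumFields.BalabanUV.T4Continuum.ShiftedZerothOrder (ShiftLaws)
open Summit.QuantumFields.BalabanUV.T4Continuum.NE2FromNE3 (bgReadings consistent_of_localRate_lev)
open Summit.QuantumFields.BalabanUV.T4Continuum.RegularBackgroundTower (betaNE3 lipschitzBackgroundM_of_regular boundedBackgroundM_of_regular)
open Summit.QuantumFields.BalabanUV.T4Continuum.GaugeTermDecomposition (liftR)
open Summit.QuantumFields.BalabanUV.T4Continuum.LatticeWeitzenbock (curlOp divOp)
open Summit.QuantumFields.BalabanUV.T4Continuum.WeitzenbockBridge (lift D0 slotLift hodge_sub_covLapC)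
open Summit.QuantumFields.BalabanUV.T4Continuum.HodgeCorrectionLaws (hodgeCorr hodgeCorr_trivial)
open Summit.QuantumFields.BalabanUV.T4Continuum.HolonomyTowerRegular

variable {d : ℕ} (L : ℕ) [NeZero L] (M : Fin d → ℕ) [hM : ∀ μ, NeZero (M μ)] (a : ℝ) (ha : 0 < a) {o : Type*} [Fintype o] [DecidableEq o]

/-- **THE HODGE-FORM MODEL PERTURBATION** `hodgePert k = covPertC (liftR ∘ Rb) k + hodgeCorr Rb k` (row B2's summand plus the Weitzenböck
correction) for slot-independent site transporters. [folklore] -/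
def hodgePert (Rb : (k : ℕ) → Fin d → Tor (fine (lev L k) M) → Matrix o o ℂ) (k : ℕ) : Matrix (idx L M k × o) (idx L M k × o) ℂ :=
  covPertC L M (fun k => liftR (fine (lev L k) M) (Rb k)) k + hodgeCorr L M Rb k

/-- **`hodgePert k = lift (½•curlᴴcurl + divᴴdiv) − Lap ⊗ 1`** (EXACT): the Hodge-form covariant operator of [LatticeWeitzenbock] on the
0-form covariant differences `D0 (L^k) (Rb k)`, reindexed, minus the free componentwise Laplacian `lapC`. [folklore] -/
theorem hodgePert_eq (Rb : (k : ℕ) → Fin d → Tor (fine (lev L k) M) → Matrix o o ℂ) (k : ℕ) :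
    hodgePert L M Rb k
      = lift (fine (lev L k) M)
          ((2 : ℂ)⁻¹ • ((curlOp (D0 (fine (lev L k) M) (((lev L k : ℕ) : ℂ)) (Rb k)))ᴴ * curlOp (D0 (fine (lev L k) M) (((lev L k : ℕ) : ℂ)) (Rb k)))
            + (divOp (D0 (fine (lev L k) M) (((lev L k : ℕ) : ℂ)) (Rb k)))ᴴ * divOp (D0 (fine (lev L k) M) (((lev L k : ℕ) : ℂ)) (Rb k)))
        - lapC (fine (lev L k) M) (((lev L k : ℕ) : ℂ)) := by
  have h := hodge_sub_covLapC (fine (lev L k) M) (((lev L k : ℕ) : ℂ)) (Rb k) (o := o)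
  rw [hodgePert, hodgeCorr, covPertC, ← h, slotLift_eq_liftR]
  abel

/-- at the trivial background the Hodge-form perturbation VANISHES (`covPertC 1 = 0`, `hodgeCorr 1 = 0`): the model operator is `Δ_a ⊗ 1`
there BY CONSTRUCTION (c5). [folklore] -/
theorem hodgePert_trivial (k : ℕ) : hodgePert L M (fun k _ (_ : Tor (fine (lev L k) M)) => (1 : Matrix o o ℂ)) k = 0 := by
  rw [hodgePert, hodgeCorr_trivial, add_zero, covPertC, sub_eq_zero, covLapC, lapC]
  refine Finset.sum_congr rfl fun ν _ => ?_
  have h1 : ColourCovariantLaplacian.covDc (fine (lev L k) M) (((lev L k : ℕ) : ℂ))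
      (liftR (fine (lev L k) M) fun _ (_ : Tor (fine (lev L k) M)) => (1 : Matrix o o ℂ)) ν
      = fdiff (fine (lev L k) M) (((lev L k : ℕ) : ℂ)) ν ⊗ₖ (1 : Matrix o o ℂ) := by
    rw [ColourCovariantLaplacian.covDc]
    have hs : siteMul (fun i : Tor (fine (lev L k) M) × Fin d => liftR (fine (lev L k) M) (fun _ (_ : Tor (fine (lev L k) M)) =>
        (1 : Matrix o o ℂ)) ν i) = 1 := siteMul_one
    rw [hs, Matrix.one_mul, fdiff, Matrix.smul_kronecker, sub_kronecker, Matrix.one_kronecker_one]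
  rw [h1]

section Laws

variable {Rb : (k : ℕ) → Fin d → Tor (fine (lev L k) M) → Matrix o o ℂ} {α β β₂ cm : ℝ}

/-- **ROW B2's LAW RE-FED FROM THE B2.w BINDERS** (`d ≥ 1`): `hreg₂ : RegularSites Rb α β β₂` and `hNE3 : LocalRate (bgReadings (regClass₂ Rb)) C L⁻¹`
give the target shape for `covPertC (liftR ∘ Rb)` with `κ = kappaCol o d a α (max β βNE3) (d(α² + 2β))`,
`C₂ = C2col o d L a α (max β βNE3) (d(2α(βNE3 + β) + 2(βNE3 + β₂)))`, `βNE3 = 2·card o·C` — row B5's feeds `lipschitzBackgroundM_of_regular` /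
`boundedBackgroundM_of_regular` with the derivative-tower consistency taken from `dconnTower_consistent`. [folklore] -/
theorem perturbationLaws_covariantLaplacian_of_regular₂ (hd : 1 ≤ d) (h : RegularSites L M Rb α β β₂) {C : ℝ} (hC : 0 ≤ C)
    (hNE3 : LocalRate (bgReadings L M (regClass₂ L M Rb)) C ((L : ℝ)⁻¹)) :
    PerturbationLaws (fun k => calDalev L M a ha k ⊗ₖ (1 : Matrix o o ℂ)) (covPertC L M (fun k => liftR (fine (lev L k) M) (Rb k)))
      (fun k => JpcT L M k ⊗ₖ (1 : Matrix o o ℂ)) (kappaCol o d a α (max β (betaNE3 o C)) (d * (α ^ 2 + 2 * β)))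
      (fun k => C2col o d L a α (max β (betaNE3 o C)) (d * (2 * α * (betaNE3 o C + β) + 2 * (betaNE3 o C + β₂))) * ((L : ℝ)⁻¹) ^ k) := by
  have hb : 0 ≤ betaNE3 o C := by unfold betaNE3; positivity
  have hb₂ : 0 ≤ betaNE3 o C + β₂ := add_nonneg hb h.nonneg.2.2
  have hw := consistent_of_localRate_lev L M hC hNE3 (wT_mem_regClass₂ : wT L M Rb ∈ regClass₂ L M Rb)
  have hD := fun lam => consistent_of_localRate_lev L M hC hNE3 (DqT_mem_regClass₂ lam : DqT L M Rb lam ∈ regClass₂ L M Rb)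
  have hV := lipschitzBackgroundM_of_regular L M h.toRegularTransporters (fun k ν i => hw k ν i)
  have hz := boundedBackgroundM_of_regular L M h.toRegularTransporters hb hb₂ (fun k ν i => hw k ν i)
    (fun k ν i => dconnTower_consistent h (fun k lam ν i => hD lam k ν i) k ν i)
  exact perturbationLaws_colourCovariantLaplacian L M a ha hd (fun p => lipschitzBackground_entry L M hV p)
    (fun p => boundedBackground_entry L M hz p)

/-- **THE HODGE-FORM MODEL's `PerturbationLaws` — THE ALTERNATIVE B2 SLOT** (`d ≥ 1`): binders `hreg₂ : RegularSites Rb α β β₂` ((3.35)+(3.36)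
shapes), `hNE3 : LocalRate (bgReadings (regClass₂ Rb)) C L⁻¹` (node NE3 BY NAME on `{w} ∪ {D_lam w}`), `hS` (mixed-shift laws, the owner's
`shiftLaws_mixed`, `cm = 2Cst`) ⟹ the target shape for `hodgePert L M Rb = covPertC + hodgeCorr` with `κ = κ_col + d²(2β + 2α²)Cst`,
`C₂ = C₂^col + d²·Cst·((2β + 2α²)·cm + (2(βNE3 + β₂) + 4α(βNE3 + β))·Cst)`.  NOT NE2; no B0. [folklore] -/
theorem perturbationLaws_hodgeModel (hd : 1 ≤ d) (h : RegularSites L M Rb α β β₂) {C : ℝ} (hC : 0 ≤ C)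
    (hNE3 : LocalRate (bgReadings L M (regClass₂ L M Rb)) C ((L : ℝ)⁻¹))
    (hS : ∀ μ ν, ShiftLaws L M a ha (fun k => ((shiftM (fine (lev L k) M) μ)ᴴ * shiftM (fine (lev L k) M) ν) ⊗ₖ (1 : Matrix o o ℂ)) cm) :
    PerturbationLaws (fun k => calDalev L M a ha k ⊗ₖ (1 : Matrix o o ℂ)) (hodgePert L M Rb) (fun k => JpcT L M k ⊗ₖ (1 : Matrix o o ℂ))
      (kappaCol o d a α (max β (betaNE3 o C)) (d * (α ^ 2 + 2 * β)) + (d : ℝ) ^ 2 * ((2 * β + 2 * α ^ 2) * Cst d a))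
      (fun k => C2col o d L a α (max β (betaNE3 o C)) (d * (2 * α * (betaNE3 o C + β) + 2 * (betaNE3 o C + β₂))) * ((L : ℝ)⁻¹) ^ k
        + (d : ℝ) ^ 2 * (Cst d a * ((2 * β + 2 * α ^ 2) * cm
          + (2 * (betaNE3 o C + β₂) + 4 * α * (betaNE3 o C + β)) * Cst d a)) * ((L : ℝ)⁻¹) ^ k) :=
  perturbationLaws_add (perturbationLaws_covariantLaplacian_of_regular₂ L M a ha hd h hC hNE3)
    (perturbationLaws_hodgeCorrection_of_regular_localRate a ha h hC hNE3 hS)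

end Laws

/-! ## (v1.1 append) The mixed-shift law DISCHARGED by the owner's `shiftLaws_mixed` (`ShiftedZerothOrder` v1.1, p209079/p209934) -/

section Discharged

variable {Rb : (k : ℕ) → Fin d → Tor (fine (lev L k) M) → Matrix o o ℂ} {α β β₂ : ℝ}

/-- **row B2.w's law for `hodgeCorr` WITH EXACTLY ROW B2's BINDER SHAPES** (`hreg₂`, `hNE3` on `regClass₂`; nothing else): the `hS` of
`HolonomyTowerRegular.perturbationLaws_hodgeCorrection_of_regular_localRate` discharged by `ShiftedZerothOrder.shiftLaws_mixed` (`cm = 2Cst`).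
NOT NE2; model level; no B0. [folklore] -/
theorem perturbationLaws_hodgeCorrection_of_regular_localRate_mixed (h : RegularSites L M Rb α β β₂) {C : ℝ} (hC : 0 ≤ C)
    (hNE3 : LocalRate (bgReadings L M (regClass₂ L M Rb)) C ((L : ℝ)⁻¹)) :
    PerturbationLaws (Dc L M a ha) (hodgeCorr L M Rb) (Jc L M)
      ((d : ℝ) ^ 2 * ((2 * β + 2 * α ^ 2) * Cst d a))
      (fun k => (d : ℝ) ^ 2 * (Cst d a * ((2 * β + 2 * α ^ 2) * (2 * Cst d a)
        + (2 * (betaNE3 o C + β₂) + 4 * α * (betaNE3 o C + β)) * Cst d a)) * ((L : ℝ)⁻¹) ^ k) :=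
  perturbationLaws_hodgeCorrection_of_regular_localRate a ha h hC hNE3 fun μ ν => ShiftedZerothOrder.shiftLaws_mixed L M a ha (o := o) μ ν

/-- **THE HODGE-FORM MODEL's `PerturbationLaws` WITH EXACTLY ROW B2's BINDER SHAPES** (`d ≥ 1`): `hreg₂ : RegularSites Rb α β β₂`,
`hNE3 : LocalRate (bgReadings (regClass₂ Rb)) C L⁻¹` ⟹ the target shape for `hodgePert L M Rb` — `perturbationLaws_hodgeModel` with the mixed-shift
`ShiftLaws` discharged by the owner's `shiftLaws_mixed` (`cm = 2Cst`).  The ALTERNATIVE B2 slot (referee c11: a variant, not the instance of record);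
NOT NE2; no B0. [folklore] -/
theorem perturbationLaws_hodgeModel_mixed (hd : 1 ≤ d) (h : RegularSites L M Rb α β β₂) {C : ℝ} (hC : 0 ≤ C)
    (hNE3 : LocalRate (bgReadings L M (regClass₂ L M Rb)) C ((L : ℝ)⁻¹)) :
    PerturbationLaws (fun k => calDalev L M a ha k ⊗ₖ (1 : Matrix o o ℂ)) (hodgePert L M Rb) (fun k => JpcT L M k ⊗ₖ (1 : Matrix o o ℂ))
      (kappaCol o d a α (max β (betaNE3 o C)) (d * (α ^ 2 + 2 * β)) + (d : ℝ) ^ 2 * ((2 * β + 2 * α ^ 2) * Cst d a))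
      (fun k => C2col o d L a α (max β (betaNE3 o C)) (d * (2 * α * (betaNE3 o C + β) + 2 * (betaNE3 o C + β₂))) * ((L : ℝ)⁻¹) ^ k
        + (d : ℝ) ^ 2 * (Cst d a * ((2 * β + 2 * α ^ 2) * (2 * Cst d a)
          + (2 * (betaNE3 o C + β₂) + 4 * α * (betaNE3 o C + β)) * Cst d a)) * ((L : ℝ)⁻¹) ^ k) :=
  perturbationLaws_hodgeModel L M a ha hd h hC hNE3 fun μ ν => ShiftedZerothOrder.shiftLaws_mixed L M a ha (o := o) μ ν

end Discharged

end Summit.QuantumFields.BalabanUV.T4Continuum.HodgeModelSlot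

end
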